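import Summits.ValiantsHypothesis.ValiantsHypothesis.Theorems.LacunarySymmetroidMatrixDescartesCensusPivotKit

/-!
# `MatrixDescartes` census — pivot column: the LOEWNER-CONVEXITY LAW (every size `m`, every `K`, every index):
# the NSD locus of a pivot pencil is an interval and carries at most TWO determinant roots

HONEST FRAMING.  Object-search cell `pub-symmetroid`, Conjecture-B column in PIVOT currency (`…CensusPivotDefs.lean`:
`pivotPosRoots`, `PivotRootLawAt`; seat conjb-1), seat `val-sym-mdr-p1` (generation 6).  Helper file landed `--supports`
the crux item stmt-ValiantsHypothesis-18050 (`Theses.LacunarySymmetroid.MatrixDescartes`, OPEN, on HOLD) with NO closure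
claim.  STRUCTURAL SECTOR LAW about ONE arbitrary pivot pencil `F(x) = x^e • J + ∑ₖ x^{dₖ} • Pₖ` (`J` real symmetric of ANY
signature, `Pₖ ⪰ 0`, any size `m`, any number of letters `K`, any exponents, ties allowed); it complements the
PIVOT-VALLEY LAW of `…PivotValley.lean` (seat val-sym-mdr-p2, gen 5: Loewner MONOTONICITY of `u ↦ F(u)/u^e` on the two
flanks) by the second-order statement valid everywhere:
* **LOEWNER CONVEXITY** (`convexOn_normForm`, `quadForm_eq_pow_mul_normForm`): for every vector `v` the normalised form
  `s ↦ e^{−es}·vᵀF(e^s)v = vᵀJv + ∑ₖ e^{(dₖ−e)s}·vᵀPₖv` is CONVEX in `s = log x` (constant + non-negative combination of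
  exponentials): `u ↦ F(u)/u^e` is Loewner-convex in `log u`; the free letter becomes CONSTANT, so no sign hypothesis on
  `J` is needed.
* **THE NSD LOCUS IS AN INTERVAL** (`quadForm_nonpos_between`, `negSemidef_between`): `0 < x ≤ y ≤ z`, `F(x) ⪯ 0`,
  `F(z) ⪯ 0 ⇒ F(y) ⪯ 0`.
* **AT MOST TWO NSD ROOTS** (`card_posRoots_negSemidef_le_two`): at most two of the distinct positive zeros `t` of
  `det F` have `F(t) ⪯ 0` (the top-eigenvalue branch `λ_max(F(t)) = 0`) — no hypothesis beyond `J` symmetric, `Pₖ ⪰ 0`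
  (if `det F ≡ 0` there are no roots at all).  Proof: three such roots `x₁ < x₂ < x₃` and a kernel vector `u` of `F(x₂)`
  give a convex function `≤ 0` at `log x₁, log x₃` and `= 0` in between, hence `≡ 0` on `[log x₁, log x₃]`
  (`convexOn_eq_zero_on_Icc`); with `F ⪯ 0` there, `F(x)u = 0` on an interval, so `F(X)·u = 0` and `det F(X) = 0`.
* **`m = 2` READING** (`posSemidef_or_negSemidef_of_det_eq_zero`, `pivotPosRoots_le_two_add_card_posSemidef`): a
  singular real symmetric `2 × 2` matrix is semidefinite, so `Z₊ ≤ 2 + #{positive roots t with F(t) ⪰ 0}`: all but at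
  most two positive roots of a `2 × 2` pivot pencil are PSD-boundary roots (`λ_min = 0 ≤ λ_max`) — the structural split
  behind the `(2,K)` pivot rows (`= 6` at `K = 3`, `≥ 8` at `K = 4`: tree `…PivotTwoThree`, `…PivotTwoFourWitness`).
Nothing here bears on `Theses.LacunarySymmetroid.MatrixDescartes` in its window, on `KPlusLogSqLaw`, on `DoorA26` /
`DoorA34`, on the cell's registers or credences, or on `VP ≠ VNP`.

[folklore] Elementary: convexity of `exp` and Mathlib's `ConvexOn` three-point lemmas, the `Matrix.PosSemidef` API,
`Matrix.exists_mulVec_eq_zero_iff` over the domain `ℝ[X]`, `Polynomial.eq_zero_of_infinite_isRoot`, tree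
`Pivot.eval_det_pivot`.  No definitions, no named facts.
-/

-- `Summit.ValiantsHypothesis.ValiantsHypothesis.…` repeats a component by the D-0017 layout
-- (single-conjunct summit), which the `dupNamespace` linter flags; the name is mandated.
set_option linter.dupNamespace false

namespace Summit.ValiantsHypothesis.ValiantsHypothesis.Theorems.LacunarySymmetroidMatrixDescartes.Pivot.Convexity

open Matrix Finset Polynomial
open scoped BigOperators

/-! ## 1. Convexity of exponential sums with non-negative weights -/

/-- `s ↦ exp (a·s)` is convex on `ℝ` for every real `a`. [folklore] -/
theorem convexOn_exp_mul (a : ℝ) : ConvexOn ℝ Set.univ (fun s : ℝ => Real.exp (a * s)) := by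
  refine ⟨convex_univ, fun x _ y _ θ η hθ hη hθη => ?_⟩
  have h := convexOn_exp.2 (Set.mem_univ (a * x)) (Set.mem_univ (a * y)) hθ hη hθη
  simp only [smul_eq_mul] at h ⊢
  calc Real.exp (a * (θ * x + η * y)) = Real.exp (θ * (a * x) + η * (a * y)) := by ring_nf
    _ ≤ θ * Real.exp (a * x) + η * Real.exp (a * y) := h

/-- A constant plus a non-negative combination of exponentials `s ↦ c + ∑ₖ wₖ · exp (aₖ s)` (`wₖ ≥ 0`) is convex
on `ℝ`. [folklore] -/
theorem convexOn_const_add_sum_exp {K : ℕ} (c : ℝ) (a w : Fin K → ℝ) (hw : ∀ k, 0 ≤ w k) :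
    ConvexOn ℝ Set.univ (fun s : ℝ => c + ∑ k, Real.exp (a k * s) * w k) := by
  refine ⟨convex_univ, fun x _ y _ θ η hθ hη hθη => ?_⟩
  simp only [smul_eq_mul]
  have hk : ∀ k, Real.exp (a k * (θ * x + η * y)) * w k
      ≤ θ * (Real.exp (a k * x) * w k) + η * (Real.exp (a k * y) * w k) := by
    intro k
    have h := (convexOn_exp_mul (a k)).2 (Set.mem_univ x) (Set.mem_univ y) hθ hη hθη
    simp only [smul_eq_mul] at h
    have := mul_le_mul_of_nonneg_right h (hw k)
    linarith [this]
  calc c + ∑ k, Real.exp (a k * (θ * x + η * y)) * w k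
      ≤ c + ∑ k, (θ * (Real.exp (a k * x) * w k) + η * (Real.exp (a k * y) * w k)) := by
        have := Finset.sum_le_sum fun k (_ : k ∈ (Finset.univ : Finset (Fin K))) => hk k
        linarith
    _ = θ * (c + ∑ k, Real.exp (a k * x) * w k) + η * (c + ∑ k, Real.exp (a k * y) * w k) := by
        rw [Finset.sum_add_distrib, ← Finset.mul_sum, ← Finset.mul_sum]
        have : c = θ * c + η * c := by rw [← add_mul, hθη, one_mul]
        linarith

/-- A convex function on `ℝ` which is `≤ 0` at `a` and `c` and `= 0` at an intermediate point `a < b < c` vanishes on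
the whole interval `[a, c]`. [folklore] -/
theorem convexOn_eq_zero_on_Icc {f : ℝ → ℝ} (hf : ConvexOn ℝ Set.univ f) {a b c : ℝ} (hab : a < b) (hbc : b < c)
    (ha : f a ≤ 0) (hc : f c ≤ 0) (hb : f b = 0) : ∀ w ∈ Set.Icc a c, f w = 0 := by
  have hfa : f a = 0 := le_antisymm ha (by
    simpa only [hb] using hf.le_left_of_right_le'' (Set.mem_univ a) (Set.mem_univ c) hab.le hbc (hb.symm ▸ hc))
  have hfc : f c = 0 := le_antisymm hc (by
    simpa only [hb] using hf.le_right_of_left_le'' (Set.mem_univ a) (Set.mem_univ c) hab hbc.le (hb.symm ▸ ha))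
  intro w hw
  obtain ⟨haw, hwc⟩ := hw
  rcases le_or_gt w b with hwb | hbw
  · -- `a ≤ w ≤ b < c`
    have h1 : f w ≤ max (f a) (f b) :=
      hf.le_on_segment (Set.mem_univ a) (Set.mem_univ b) (by rw [segment_eq_Icc hab.le]; exact ⟨haw, hwb⟩)
    rw [hfa, hb, max_self] at h1
    have h2 := hf.le_left_of_right_le'' (Set.mem_univ w) (Set.mem_univ c) hwb hbc (by rw [hb, hfc])
    exact le_antisymm h1 (hb ▸ h2)
  · -- `a < b < w ≤ c`
    have h1 : f w ≤ max (f b) (f c) :=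
      hf.le_on_segment (Set.mem_univ b) (Set.mem_univ c) (by rw [segment_eq_Icc hbc.le]; exact ⟨hbw.le, hwc⟩)
    rw [hfc, hb, max_self] at h1
    have h2 := hf.le_right_of_left_le'' (Set.mem_univ a) (Set.mem_univ w) hab hbw.le (by rw [hb, hfa])
    exact le_antisymm h1 (hb ▸ h2)

/-! ## 2. The normalised quadratic form of a pivot pencil -/

variable {m K : ℕ}

/-- Expansion of the quadratic form of the evaluated pivot pencil:
`vᵀ(t^e J + ∑ t^{dₖ} Pₖ)v = t^e · vᵀJv + ∑ₖ t^{dₖ} · vᵀPₖv`. [folklore] -/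
theorem quadForm_eval_pencil (e : ℕ) (d : Fin K → ℕ) (J : Matrix (Fin m) (Fin m) ℝ)
    (P : Fin K → Matrix (Fin m) (Fin m) ℝ) (v : Fin m → ℝ) (t : ℝ) :
    v ⬝ᵥ ((t ^ e • J + ∑ k, t ^ d k • P k) *ᵥ v)
      = t ^ e * (v ⬝ᵥ (J *ᵥ v)) + ∑ k, t ^ d k * (v ⬝ᵥ (P k *ᵥ v)) := by
  simp only [Matrix.add_mulVec, Matrix.sum_mulVec, Matrix.smul_mulVec, dotProduct_add, dotProduct_sum,
    dotProduct_smul, smul_eq_mul]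

/-- **Normalisation by the pivot monomial.**  For `t > 0`,
`vᵀ F(t) v = t^e · (vᵀJv + ∑ₖ exp((dₖ − e)·log t) · vᵀPₖv)`: dividing by `t^e` makes the free letter constant and
turns every PSD letter into an exponential of `log t`. [folklore] -/
theorem quadForm_eq_pow_mul_normForm (e : ℕ) (d : Fin K → ℕ) (J : Matrix (Fin m) (Fin m) ℝ)
    (P : Fin K → Matrix (Fin m) (Fin m) ℝ) (v : Fin m → ℝ) {t : ℝ} (ht : 0 < t) :
    v ⬝ᵥ ((t ^ e • J + ∑ k, t ^ d k • P k) *ᵥ v)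
      = t ^ e * (v ⬝ᵥ (J *ᵥ v) + ∑ k, Real.exp (((d k : ℝ) - e) * Real.log t) * (v ⬝ᵥ (P k *ᵥ v))) := by
  rw [quadForm_eval_pencil, mul_add, Finset.mul_sum]
  congr 1
  refine Finset.sum_congr rfl fun k _ => ?_
  have hte : t ^ e ≠ 0 := pow_ne_zero _ ht.ne'
  have hk : Real.exp (((d k : ℝ) - e) * Real.log t) = t ^ d k / t ^ e := by
    rw [sub_mul, Real.exp_sub, Real.exp_nat_mul, Real.exp_nat_mul, Real.exp_log ht]
  rw [hk, ← mul_assoc, mul_div_cancel₀ _ hte]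

/-- **LOEWNER CONVEXITY (per direction).**  For `Pₖ ⪰ 0` and any real matrix `J`, the normalised quadratic form
`s ↦ vᵀJv + ∑ₖ exp((dₖ − e)s) · vᵀPₖv` (`= e^{−es} vᵀF(e^s)v`) is convex on `ℝ`: the curve `u ↦ F(u)/u^e` is
Loewner-convex in `log u`. [folklore] -/
theorem convexOn_normForm (e : ℕ) (d : Fin K → ℕ) (J : Matrix (Fin m) (Fin m) ℝ)
    (P : Fin K → Matrix (Fin m) (Fin m) ℝ) (hP : ∀ k, (P k).PosSemidef) (v : Fin m → ℝ) :
    ConvexOn ℝ Set.univ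
      (fun s : ℝ => v ⬝ᵥ (J *ᵥ v) + ∑ k, Real.exp (((d k : ℝ) - e) * s) * (v ⬝ᵥ (P k *ᵥ v))) := by
  refine convexOn_const_add_sum_exp (v ⬝ᵥ (J *ᵥ v)) (fun k => (d k : ℝ) - e) (fun k => v ⬝ᵥ (P k *ᵥ v)) ?_
  intro k
  simpa only [star_trivial] using (hP k).dotProduct_mulVec_nonneg v

/-! ## 3. The NSD set of a pivot pencil is an interval -/

/-- **Per-direction quasi-convexity.**  `Pₖ ⪰ 0`, `J` arbitrary; if `vᵀF(x)v ≤ 0` and `vᵀF(z)v ≤ 0` at two positive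
points `x ≤ z`, then `vᵀF(y)v ≤ 0` at every `y ∈ [x, z]`. [folklore] -/
theorem quadForm_nonpos_between (e : ℕ) (d : Fin K → ℕ) (J : Matrix (Fin m) (Fin m) ℝ)
    (P : Fin K → Matrix (Fin m) (Fin m) ℝ) (hP : ∀ k, (P k).PosSemidef) (v : Fin m → ℝ) {x y z : ℝ}
    (hx : 0 < x) (hxy : x ≤ y) (hyz : y ≤ z)
    (h₁ : v ⬝ᵥ ((x ^ e • J + ∑ k, x ^ d k • P k) *ᵥ v) ≤ 0)
    (h₃ : v ⬝ᵥ ((z ^ e • J + ∑ k, z ^ d k • P k) *ᵥ v) ≤ 0) :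
    v ⬝ᵥ ((y ^ e • J + ∑ k, y ^ d k • P k) *ᵥ v) ≤ 0 := by
  have hy : 0 < y := hx.trans_le hxy
  have hz : 0 < z := hy.trans_le hyz
  set f : ℝ → ℝ := fun s => v ⬝ᵥ (J *ᵥ v) + ∑ k, Real.exp (((d k : ℝ) - e) * s) * (v ⬝ᵥ (P k *ᵥ v)) with hf
  have hconv : ConvexOn ℝ Set.univ f := convexOn_normForm e d J P hP v
  have hsign : ∀ {t : ℝ}, 0 < t →
      (v ⬝ᵥ ((t ^ e • J + ∑ k, t ^ d k • P k) *ᵥ v) ≤ 0 ↔ f (Real.log t) ≤ 0) := by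
    intro t ht
    rw [quadForm_eq_pow_mul_normForm e d J P v ht]
    have hte : 0 < t ^ e := pow_pos ht _
    refine ⟨fun h => ?_, fun h => mul_nonpos_of_nonneg_of_nonpos hte.le h⟩
    by_contra hneg
    exact absurd h (not_le.mpr (mul_pos hte (lt_of_not_ge hneg)))
  rw [hsign hy]
  have h1 := (hsign hx).1 h₁
  have h3 := (hsign hz).1 h₃
  have hseg : Real.log y ∈ segment ℝ (Real.log x) (Real.log z) := by
    rw [segment_eq_Icc ((Real.log_le_log_iff hx hz).2 (hxy.trans hyz))]
    exact ⟨(Real.log_le_log_iff hx hy).2 hxy, (Real.log_le_log_iff hy hz).2 hyz⟩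
  have := hconv.le_on_segment (Set.mem_univ _) (Set.mem_univ _) hseg
  exact this.trans (max_le h1 h3)

/-- The evaluated pivot pencil is symmetric when `J` is symmetric and the `Pₖ` are PSD. [folklore] -/
theorem isHermitian_eval_pencil (e : ℕ) (d : Fin K → ℕ) (J : Matrix (Fin m) (Fin m) ℝ)
    (P : Fin K → Matrix (Fin m) (Fin m) ℝ) (hJ : J.IsSymm) (hP : ∀ k, (P k).PosSemidef) (t : ℝ) :
    (t ^ e • J + ∑ k, t ^ d k • P k).IsHermitian := by
  have hPs : ∀ k, (P k).IsSymm := fun k => by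
    have h := (hP k).isHermitian
    unfold Matrix.IsHermitian at h
    rwa [Matrix.conjTranspose_eq_transpose_of_trivial] at h
  refine Matrix.isHermitian_iff_isSymm.2 ?_
  unfold Matrix.IsSymm at hJ hPs ⊢
  rw [Matrix.transpose_add, Matrix.transpose_smul, hJ, Matrix.transpose_sum]
  congr 1
  exact Finset.sum_congr rfl fun k _ => by rw [Matrix.transpose_smul, hPs k]

/-- **THE NSD SET IS AN INTERVAL.**  For a pivot pencil (`J` symmetric of any signature, `Pₖ ⪰ 0`, any size, any
exponents) and `0 < x ≤ y ≤ z`: `F(x) ⪯ 0` and `F(z) ⪯ 0` imply `F(y) ⪯ 0`. [folklore] -/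
theorem negSemidef_between (e : ℕ) (d : Fin K → ℕ) (J : Matrix (Fin m) (Fin m) ℝ)
    (P : Fin K → Matrix (Fin m) (Fin m) ℝ) (hJ : J.IsSymm) (hP : ∀ k, (P k).PosSemidef) {x y z : ℝ}
    (hx : 0 < x) (hxy : x ≤ y) (hyz : y ≤ z)
    (h₁ : (-(x ^ e • J + ∑ k, x ^ d k • P k)).PosSemidef)
    (h₃ : (-(z ^ e • J + ∑ k, z ^ d k • P k)).PosSemidef) :
    (-(y ^ e • J + ∑ k, y ^ d k • P k)).PosSemidef := by
  refine Matrix.PosSemidef.of_dotProduct_mulVec_nonneg (isHermitian_eval_pencil e d J P hJ hP y).neg fun w => ?_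
  have hw₁ := h₁.dotProduct_mulVec_nonneg w
  have hw₃ := h₃.dotProduct_mulVec_nonneg w
  simp only [star_trivial, Matrix.neg_mulVec, dotProduct_neg, neg_nonneg] at hw₁ hw₃ ⊢
  exact quadForm_nonpos_between e d J P hP w hx hxy hyz hw₁ hw₃

/-! ## 4. At most two NSD roots -/

/-- Entrywise evaluation: the polynomial vector `F(X) · (C ∘ u)` evaluates at `t` to `F(t) · u`. [folklore] -/
theorem eval_mulVec_pivot (e : ℕ) (d : Fin K → ℕ) (J : Matrix (Fin m) (Fin m) ℝ)
    (P : Fin K → Matrix (Fin m) (Fin m) ℝ) (u : Fin m → ℝ) (t : ℝ) (i : Fin m) :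
    (((((X : ℝ[X]) ^ e) • J.map Polynomial.C + ∑ k, ((X : ℝ[X]) ^ d k) • (P k).map Polynomial.C)
        *ᵥ (fun j => Polynomial.C (u j))) i).eval t
      = ((t ^ e • J + ∑ k, t ^ d k • P k) *ᵥ u) i := by
  simp only [Matrix.mulVec, dotProduct, Matrix.add_apply, Matrix.smul_apply, Matrix.map_apply, Matrix.sum_apply,
    smul_eq_mul, Polynomial.eval_finsetSum, Polynomial.eval_mul, Polynomial.eval_add, Polynomial.eval_pow,
    Polynomial.eval_X, Polynomial.eval_C]

open scoped Classical in
/-- **AT MOST TWO NSD ROOTS** (every size `m`, every `K`, every index).  For a pivot pencil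
`F = X^e J + ∑ X^{dₖ} Pₖ` (`J` symmetric, `Pₖ ⪰ 0`), at most two of the distinct positive zeros `t` of `det F` have
`F(t) ⪯ 0` (the top-eigenvalue branch `λ_max(F(t)) = 0` contributes at most two roots). [folklore] -/
theorem card_posRoots_negSemidef_le_two (e : ℕ) (d : Fin K → ℕ) (J : Matrix (Fin m) (Fin m) ℝ)
    (P : Fin K → Matrix (Fin m) (Fin m) ℝ) (hJ : J.IsSymm) (hP : ∀ k, (P k).PosSemidef) :
    ((Matrix.det (((X : ℝ[X]) ^ e) • J.map Polynomial.C
        + ∑ k, ((X : ℝ[X]) ^ d k) • (P k).map Polynomial.C)).roots.toFinset.filter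
        (fun t => 0 < t ∧ (-(t ^ e • J + ∑ k, t ^ d k • P k)).PosSemidef)).card ≤ 2 := by
  classical
  set Fp : Matrix (Fin m) (Fin m) ℝ[X] :=
    ((X : ℝ[X]) ^ e) • J.map Polynomial.C + ∑ k, ((X : ℝ[X]) ^ d k) • (P k).map Polynomial.C with hFp
  set S := (Matrix.det Fp).roots.toFinset.filter
    (fun t => 0 < t ∧ (-(t ^ e • J + ∑ k, t ^ d k • P k)).PosSemidef) with hS
  by_contra hcard
  rw [not_le] at hcard
  -- the determinant is not the zero polynomial (else there are no roots at all)
  have hdet : Matrix.det Fp ≠ 0 := by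
    intro h0
    have : S = ∅ := by rw [hS, h0, Polynomial.roots_zero]; rfl
    rw [this, Finset.card_empty] at hcard
    exact absurd hcard (by norm_num)
  -- what membership in `S` says
  have hmem : ∀ {t : ℝ}, t ∈ S → 0 < t ∧ (-(t ^ e • J + ∑ k, t ^ d k • P k)).PosSemidef ∧
      (t ^ e • J + ∑ k, t ^ d k • P k).det = 0 := by
    intro t ht
    rw [hS, Finset.mem_filter, Multiset.mem_toFinset, Polynomial.mem_roots hdet] at ht
    refine ⟨ht.2.1, ht.2.2, ?_⟩
    have h := ht.1
    rw [Polynomial.IsRoot.def, hFp, eval_det_pivot] at h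
    exact h
  -- three elements `x₁ < x₂ < x₃` of `S`
  have hne : S.Nonempty := Finset.card_pos.mp (by omega)
  set x₁ := S.min' hne with hx₁
  set x₃ := S.max' hne with hx₃
  have hx₁S : x₁ ∈ S := Finset.min'_mem S hne
  have hx₃S : x₃ ∈ S := Finset.max'_mem S hne
  have hcard' : 1 < (S.erase x₁).card := by rw [Finset.card_erase_of_mem hx₁S]; omega
  obtain ⟨x₂, hx₂, hx₂₃⟩ := Finset.exists_mem_ne hcard' x₃
  have hx₂S : x₂ ∈ S := Finset.mem_of_mem_erase hx₂
  have hx₂₁ : x₂ ≠ x₁ := Finset.ne_of_mem_erase hx₂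
  have h12 : x₁ < x₂ := lt_of_le_of_ne (Finset.min'_le S x₂ hx₂S) hx₂₁.symm
  have h23 : x₂ < x₃ := lt_of_le_of_ne (Finset.le_max' S x₂ hx₂S) hx₂₃
  obtain ⟨hx₁pos, hN₁, -⟩ := hmem hx₁S
  obtain ⟨hx₂pos, -, hdet₂⟩ := hmem hx₂S
  obtain ⟨hx₃pos, hN₃, -⟩ := hmem hx₃S
  -- a kernel vector `u` of `F(x₂)` and its convex normalised form `f`
  obtain ⟨u, hu0, hu⟩ := Matrix.exists_mulVec_eq_zero_iff.mpr hdet₂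
  set f : ℝ → ℝ := fun s => u ⬝ᵥ (J *ᵥ u) + ∑ k, Real.exp (((d k : ℝ) - e) * s) * (u ⬝ᵥ (P k *ᵥ u)) with hf
  have hconv : ConvexOn ℝ Set.univ f := convexOn_normForm e d J P hP u
  have hform : ∀ {t : ℝ}, 0 < t → u ⬝ᵥ ((t ^ e • J + ∑ k, t ^ d k • P k) *ᵥ u) = t ^ e * f (Real.log t) :=
    fun ht => quadForm_eq_pow_mul_normForm e d J P u ht
  have hnonpos : ∀ {t : ℝ}, 0 < t → (-(t ^ e • J + ∑ k, t ^ d k • P k)).PosSemidef → f (Real.log t) ≤ 0 := by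
    intro t ht hN
    have h := hN.dotProduct_mulVec_nonneg u
    simp only [star_trivial, Matrix.neg_mulVec, dotProduct_neg, neg_nonneg] at h
    rw [hform ht] at h
    by_contra hneg
    exact absurd h (not_le.mpr (mul_pos (pow_pos ht _) (lt_of_not_ge hneg)))
  have hf₁ := hnonpos hx₁pos hN₁
  have hf₃ := hnonpos hx₃pos hN₃
  have hf₂ : f (Real.log x₂) = 0 := by
    have h := hform hx₂pos
    rw [hu, dotProduct_zero] at h
    exact (mul_eq_zero.mp h.symm).resolve_left (pow_ne_zero _ hx₂pos.ne')
  have hzero := convexOn_eq_zero_on_Icc hconv (Real.log_lt_log hx₁pos h12) (Real.log_lt_log hx₂pos h23) hf₁ hf₃ hf₂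
  -- hence `F(t) u = 0` on the whole interval `[x₁, x₃]`
  have hker : ∀ t ∈ Set.Icc x₁ x₃, (t ^ e • J + ∑ k, t ^ d k • P k) *ᵥ u = 0 := by
    intro t ht
    have htpos : 0 < t := hx₁pos.trans_le ht.1
    have hN : (-(t ^ e • J + ∑ k, t ^ d k • P k)).PosSemidef :=
      negSemidef_between e d J P hJ hP hx₁pos ht.1 ht.2 hN₁ hN₃
    have hft : f (Real.log t) = 0 :=
      hzero _ ⟨(Real.log_le_log_iff hx₁pos htpos).2 ht.1, (Real.log_le_log_iff htpos hx₃pos).2 ht.2⟩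
    have hq : star u ⬝ᵥ ((-(t ^ e • J + ∑ k, t ^ d k • P k)) *ᵥ u) = 0 := by
      rw [star_trivial, Matrix.neg_mulVec, dotProduct_neg, hform htpos, hft, mul_zero, neg_zero]
    have h := (hN.dotProduct_mulVec_zero_iff u).1 hq
    rwa [Matrix.neg_mulVec, neg_eq_zero] at h
  -- so the polynomial vector `F(X) · u` vanishes identically
  set w : Fin m → ℝ[X] := fun j => Polynomial.C (u j) with hw
  have hw0 : w ≠ 0 := fun h => hu0 (funext fun j => by simpa [hw] using congr_fun h j)
  have hFw : Fp *ᵥ w = 0 := by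
    funext i
    apply Polynomial.eq_zero_of_infinite_isRoot
    refine Set.Infinite.mono (s := Set.Icc x₁ x₃) ?_ (Set.Icc_infinite (h12.trans h23))
    intro t ht
    simp only [Set.mem_setOf_eq, Polynomial.IsRoot.def]
    rw [hFp, eval_mulVec_pivot, hker t ht]
    rfl
  exact hdet (Matrix.exists_mulVec_eq_zero_iff.mp ⟨w, hw0, hFw⟩)

/-! ## 5. The `m = 2` reading: every root is PSD or NSD, so `Z₊ ≤ 2 + #{PSD roots}` -/

/-- A singular real symmetric `2 × 2` matrix with non-negative trace is positive semidefinite. [folklore] -/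
theorem posSemidef_of_det_eq_zero_of_trace_nonneg {M : Matrix (Fin 2) (Fin 2) ℝ} (hM : M.IsSymm)
    (hdet : M.det = 0) (htr : 0 ≤ M 0 0 + M 1 1) : M.PosSemidef := by
  have hsym : M 1 0 = M 0 1 := by simpa [Matrix.transpose_apply] using congr_fun (congr_fun hM 0) 1
  rw [Matrix.det_fin_two, hsym] at hdet
  have ha : 0 ≤ M 0 0 := by nlinarith [mul_self_nonneg (M 0 1), mul_self_nonneg (M 0 0)]
  have hc : 0 ≤ M 1 1 := by nlinarith [mul_self_nonneg (M 0 1), mul_self_nonneg (M 1 1)]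
  refine Matrix.PosSemidef.of_dotProduct_mulVec_nonneg (Matrix.isHermitian_iff_isSymm.2 hM) fun v => ?_
  simp only [star_trivial, Matrix.mulVec, dotProduct, Fin.sum_univ_two, hsym]
  -- `a·q(v) = (a v₀ + b v₁)²`, `c·q(v) = (b v₀ + c v₁)²`
  have hq1 : M 0 0 * (v 0 * (M 0 0 * v 0 + M 0 1 * v 1) + v 1 * (M 0 1 * v 0 + M 1 1 * v 1))
      = (M 0 0 * v 0 + M 0 1 * v 1) ^ 2 := by linear_combination (v 1 ^ 2) * hdet
  have hq2 : M 1 1 * (v 0 * (M 0 0 * v 0 + M 0 1 * v 1) + v 1 * (M 0 1 * v 0 + M 1 1 * v 1))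
      = (M 0 1 * v 0 + M 1 1 * v 1) ^ 2 := by linear_combination (v 0 ^ 2) * hdet
  by_cases hac : M 0 0 + M 1 1 = 0
  · have ha0 : M 0 0 = 0 := by linarith
    have hc0 : M 1 1 = 0 := by linarith
    have hb0 : M 0 1 = 0 := by
      rw [ha0, hc0] at hdet
      nlinarith [mul_self_nonneg (M 0 1)]
    rw [ha0, hb0, hc0]
    nlinarith
  · have hpos : 0 < M 0 0 + M 1 1 := lt_of_le_of_ne htr (Ne.symm hac)
    have hsum : (M 0 0 + M 1 1) * (v 0 * (M 0 0 * v 0 + M 0 1 * v 1) + v 1 * (M 0 1 * v 0 + M 1 1 * v 1))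
        = (M 0 0 * v 0 + M 0 1 * v 1) ^ 2 + (M 0 1 * v 0 + M 1 1 * v 1) ^ 2 := by
      rw [add_mul, hq1, hq2]
    by_contra hneg
    rw [not_le] at hneg
    have : (M 0 0 + M 1 1) * (v 0 * (M 0 0 * v 0 + M 0 1 * v 1) + v 1 * (M 0 1 * v 0 + M 1 1 * v 1)) < 0 :=
      mul_neg_of_pos_of_neg hpos hneg
    nlinarith [sq_nonneg (M 0 0 * v 0 + M 0 1 * v 1), sq_nonneg (M 0 1 * v 0 + M 1 1 * v 1)]

/-- **Dichotomy at `m = 2`.**  A singular real symmetric `2 × 2` matrix is positive semidefinite or negative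
semidefinite. [folklore] -/
theorem posSemidef_or_negSemidef_of_det_eq_zero {M : Matrix (Fin 2) (Fin 2) ℝ} (hM : M.IsSymm)
    (hdet : M.det = 0) : M.PosSemidef ∨ (-M).PosSemidef := by
  rcases le_or_gt 0 (M 0 0 + M 1 1) with htr | htr
  · exact Or.inl (posSemidef_of_det_eq_zero_of_trace_nonneg hM hdet htr)
  · right
    refine posSemidef_of_det_eq_zero_of_trace_nonneg ?_ ?_ ?_
    · unfold Matrix.IsSymm at hM ⊢
      rw [Matrix.transpose_neg, hM]
    · rw [Matrix.det_neg, hdet, mul_zero]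
    · simp only [Matrix.neg_apply]
      linarith

open scoped Classical in
/-- **`Z₊ ≤ 2 + #{PSD roots}` at `m = 2`.**  For a `2 × 2` pivot pencil (`J` symmetric of any signature, `Pₖ ⪰ 0`,
any `K`, any exponents) all but at most two of the distinct positive determinant roots `t` have `F(t) ⪰ 0`
(PSD-boundary roots). [folklore] -/
theorem pivotPosRoots_le_two_add_card_posSemidef (e : ℕ) (d : Fin K → ℕ) (J : Matrix (Fin 2) (Fin 2) ℝ)
    (P : Fin K → Matrix (Fin 2) (Fin 2) ℝ) (hJ : J.IsSymm) (hP : ∀ k, (P k).PosSemidef) :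
    pivotPosRoots e d J P ≤ 2 +
      ((Matrix.det (((X : ℝ[X]) ^ e) • J.map Polynomial.C
        + ∑ k, ((X : ℝ[X]) ^ d k) • (P k).map Polynomial.C)).roots.toFinset.filter
        (fun t => 0 < t ∧ (t ^ e • J + ∑ k, t ^ d k • P k).PosSemidef)).card := by
  classical
  unfold pivotPosRoots
  have h2 := card_posRoots_negSemidef_le_two e d J P hJ hP
  set Fp : Matrix (Fin 2) (Fin 2) ℝ[X] :=
    ((X : ℝ[X]) ^ e) • J.map Polynomial.C + ∑ k, ((X : ℝ[X]) ^ d k) • (P k).map Polynomial.C with hFp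
  set R := (Matrix.det Fp).roots.toFinset with hR
  by_cases hdet : Matrix.det Fp = 0
  · have : R = ∅ := by rw [hR, hdet, Polynomial.roots_zero]; rfl
    rw [this]
    simp
  have hsub : R.filter (fun t => 0 < t) ⊆
      R.filter (fun t => 0 < t ∧ (-(t ^ e • J + ∑ k, t ^ d k • P k)).PosSemidef)
        ∪ R.filter (fun t => 0 < t ∧ (t ^ e • J + ∑ k, t ^ d k • P k).PosSemidef) := by
    intro t ht
    rw [Finset.mem_filter] at ht
    obtain ⟨htR, htpos⟩ := ht
    have hroot : (t ^ e • J + ∑ k, t ^ d k • P k).det = 0 := by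
      have h := htR
      rw [hR, Multiset.mem_toFinset, Polynomial.mem_roots hdet, Polynomial.IsRoot.def, hFp, eval_det_pivot] at h
      exact h
    have hsymm : (t ^ e • J + ∑ k, t ^ d k • P k).IsSymm :=
      Matrix.isHermitian_iff_isSymm.1 (isHermitian_eval_pencil e d J P hJ hP t)
    rw [Finset.mem_union, Finset.mem_filter, Finset.mem_filter]
    rcases posSemidef_or_negSemidef_of_det_eq_zero hsymm hroot with h | h
    · exact Or.inr ⟨htR, htpos, h⟩
    · exact Or.inl ⟨htR, htpos, h⟩
  calc (R.filter (fun t => 0 < t)).card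
      ≤ (R.filter (fun t => 0 < t ∧ (-(t ^ e • J + ∑ k, t ^ d k • P k)).PosSemidef)
          ∪ R.filter (fun t => 0 < t ∧ (t ^ e • J + ∑ k, t ^ d k • P k).PosSemidef)).card :=
        Finset.card_le_card hsub
    _ ≤ (R.filter (fun t => 0 < t ∧ (-(t ^ e • J + ∑ k, t ^ d k • P k)).PosSemidef)).card
          + (R.filter (fun t => 0 < t ∧ (t ^ e • J + ∑ k, t ^ d k • P k).PosSemidef)).card :=
        Finset.card_union_le _ _
    _ ≤ 2 + (R.filter (fun t => 0 < t ∧ (t ^ e • J + ∑ k, t ^ d k • P k).PosSemidef)).card := by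
        have := h2
        omega

end Summit.ValiantsHypothesis.ValiantsHypothesis.Theorems.LacunarySymmetroidMatrixDescartes.Pivot.Convexity
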